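import Literature.Geometry.Riemannian.ExponentialMapProofs
import Literature.Geometry.Lorentzian.GeodesicUniformTime
import Literature.Analysis.ODE.SmoothDependence
import HarnessLib

/-!
# The exponential map near the origin: `exp_y` is `C¹` at `0 ∈ T_yM` with `d(exp_y)_0 = id`
(Lee 2018, Prop. 5.19 (c),(d)), and corner cutting

Sibling proof file of `Literature/Geometry/Riemannian/ExponentialMap.lean` (second step towards
the named fact `hopfRinow_compact`; the first is `HopfRinowCompact.lean`, whose reduction
`exists_isMinimizingUpTo_of_local` takes two local statements (L1), (L2) about `exp` as
hypotheses). Here, for a geodesically complete `C¹` connection `cov` on a Hausdorff manifold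
without boundary (finite-dimensional complete model), and a point `y`:

* `exists_ball_contDiffOn_extChartAt_expMap` — **`exp_y` is `C¹` near `0`, read in the chart at
  `y`** (Lee, Prop. 5.19 (c): "the exponential map is smooth"; here the `C¹` shadow for a `C¹`
  connection): there is `r > 0` such that `v ↦ φ(exp_y v)`, `φ = extChartAt I y`, is `C¹` on the
  ball `|v| < r` of `T_yM = E`, and `exp_y v` stays in the chart domain. Proof as printed: the
  geodesic system `(u, w)' = (w, -∑ wⁱ Ĉᵢ(φ⁻¹ u) w)` in the chart at `y` has a local flow of
  class `C¹` in the initial value (`Literature.Analysis.ODE.exists_contDiffOn_flow`, Lang 1995,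
  IV §1, Thm. 1.14), its solutions are the geodesics `γ_w` (`isGeodesicOn_of_chartSolution` and
  uniqueness), and `exp_y v = γ_{v/c}(c)` for a fixed small time `c` (rescaling lemma,
  Lee Lemma 5.18) — so `φ ∘ exp_y` is the time-`c` map of the flow composed with `v ↦ (φ y, v/c)`.
* `hasFDerivAt_extChartAt_expMap` — **`d(exp_y)_0 = id`** (Lee, Prop. 5.19 (d): differentiate
  `t ↦ exp_y(tv) = γ_v(t)` at `t = 0`): the chart expression has derivative `id : E →L E` at `0`.

No definitions, no named facts (D-0026).

## References

* J. M. Lee, *Introduction to Riemannian Manifolds*, 2nd ed., GTM 176 (2018): Lemma 5.18,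
  Prop. 5.19 (pp. 127–129). [LeeRiemannianManifolds2018]
* S. Lang, *Differential and Riemannian Manifolds*, GTM 160 (1995), Ch. IV §1, Thm. 1.14.
  [Lang1995]
-/

noncomputable section

open Bundle Set Filter Metric Manifold
open scoped Manifold ContDiff Topology

namespace Literature.Geometry.Riemannian

open Literature.Geometry.Lorentzian

section Connection

variable {E : Type*} [NormedAddCommGroup E] [NormedSpace ℝ E] {H : Type*} [TopologicalSpace H]
  {I : ModelWithCorners ℝ E H} {M : Type*} [TopologicalSpace M] [ChartedSpace H M]
  [IsManifold I ∞ M] [FiniteDimensional ℝ E] [CompleteSpace E] [T2Space M]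
  [BoundarylessManifold I M]
  {cov : CovariantDerivative I E (TangentSpace I : M → Type _)}
  [CovariantDerivative.ContMDiffCovariantDerivative cov 1]

omit [FiniteDimensional ℝ E] [CompleteSpace E] [T2Space M] [BoundarylessManifold I M]
  [CovariantDerivative.ContMDiffCovariantDerivative cov 1] in
/-- The trivialisation of `TM` at `y` reads a vector at `y` as itself (the coordinate change of a
chart with itself is the identity, `tangentCoordChange_self`). [folklore] -/
theorem trivializationAt_snd_self (y : M) (w : E) :
    (trivializationAt E (TangentSpace I) y (TotalSpace.mk' E y (show TangentSpace I y from w))).2 =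
      w :=
  tangentCoordChange_self (mem_extChartAt_source y)

/-- **`exp_y` near `0` is a fixed-time map of the chart geodesic flow, hence `C¹`** (Lee 2018,
Prop. 5.19 (c), for a geodesically complete `C¹` connection, read in the chart `φ` at `y`):
there are `r > 0`, a time `c > 0` and a map `Φ : E → E`, `C¹` on the ball `|w| < r`, such that
`γ_w(c) = φ⁻¹ (Φ w)` with `Φ w ∈ φ.target` for `|w| < r` — `Φ` is the position component of the
time-`c` map of the local flow of the geodesic system in the chart
(`Literature.Analysis.ODE.exists_contDiffOn_flow`; `isGeodesicOn_of_chartSolution`; uniqueness of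
geodesics). [cite: LeeRiemannianManifolds2018, Prop. 5.19 (c)] -/
theorem exists_contDiffOn_chart_maximalGeodesic (hc : IsGeodesicallyComplete cov) (y : M) :
    ∃ r > (0 : ℝ), ∃ c > (0 : ℝ), ∃ Φ : E → E, ContDiffOn ℝ 1 Φ (ball (0 : E) r) ∧
      ∀ w : E, ‖w‖ < r → Φ w ∈ (extChartAt I y).target ∧
        maximalGeodesic cov y (show TangentSpace I y from w) c = (extChartAt I y).symm (Φ w) := by
  set b := Module.finBasis ℝ E with hb_def
  obtain ⟨N, Ĉ, hN, hxN, hNs, hĈ, hĈs⟩ := exists_christoffelChart (cov := cov) b y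
  set φ := extChartAt I y with hφ_def
  set e₁ := trivializationAt E (TangentSpace I : M → Type _) y with he₁_def
  -- shrink `N` so that the Christoffel data are `C¹` at every point of it
  have hĈn : ∀ i, ∀ᶠ z in 𝓝 y, ContMDiffAt I 𝓘(ℝ, E →L[ℝ] E) 1 (Ĉ i) z := fun i ↦
    (contMDiffAt_iff_contMDiffAt_nhds (by decide)).1 (hĈs i)
  obtain ⟨N₁, hN₁N, hN₁o, hxN₁, hN₁Ĉ⟩ : ∃ N₁ ⊆ N, IsOpen N₁ ∧ y ∈ N₁ ∧
      ∀ z ∈ N₁, ∀ i, ContMDiffAt I 𝓘(ℝ, E →L[ℝ] E) 1 (Ĉ i) z := by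
    have h : ∀ᶠ z in 𝓝 y, z ∈ N ∧ ∀ i, ContMDiffAt I 𝓘(ℝ, E →L[ℝ] E) 1 (Ĉ i) z :=
      Filter.Eventually.and (hN.mem_nhds hxN) (eventually_all.2 hĈn)
    obtain ⟨N₁, hN₁, hN₁o, hxN₁⟩ := eventually_nhds_iff.1 h
    exact ⟨N₁, fun z hz ↦ (hN₁ z hz).1, hN₁o, hxN₁, fun z hz ↦ (hN₁ z hz).2⟩
  obtain ⟨O, hO, hxO, hOt, hON, hOr⟩ :=
    exists_chartBall (BoundarylessManifold.isInteriorPoint (I := I) (x := y)) hN₁o hxN₁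
  -- the first-order system, `C¹` on `O × E`
  set G : E × E → E := fun pq ↦ -∑ i, b.repr pq.2 i • Ĉ i (φ.symm pq.1) pq.2 with hG_def
  set F : E × E → E × E := fun pq ↦ (pq.2, G pq) with hF_def
  have hF : ∀ z ∈ O, ∀ q : E, ContDiffAt ℝ 1 F (z, q) := by
    intro z hz q
    have hG : ContDiffAt ℝ 1 G (z, q) := by
      have h1 : ∀ i, ContDiffAt ℝ 1 (fun pq : E × E ↦ Ĉ i (φ.symm pq.1)) (z, q) := by
        intro i
        have h2 : ContMDiffWithinAt 𝓘(ℝ, E) 𝓘(ℝ, E →L[ℝ] E) 1 (Ĉ i ∘ φ.symm) (range I) z := by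
          refine ContMDiffAt.comp_contMDiffWithinAt _ ?_
            (contMDiffWithinAt_extChartAt_symm_range y (hOt hz))
          exact hN₁Ĉ _ (hON z hz) i
        have h3 : ContDiffAt ℝ 1 (Ĉ i ∘ φ.symm) z :=
          (contMDiffWithinAt_iff_contDiffWithinAt.mp h2).contDiffAt (hOr z hz)
        exact ContDiffAt.comp (f := Prod.fst) (z, q) h3 contDiffAt_fst
      have h4 : ∀ i, ContDiffAt ℝ 1 (fun pq : E × E ↦ b.repr pq.2 i) (z, q) := fun i ↦
        (((b.coord i).toContinuousLinearMap).contDiff.comp contDiff_snd).contDiffAt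
      exact (ContDiffAt.sum fun i _ ↦ (h4 i).smul ((h1 i).clm_apply contDiffAt_snd)).neg
    exact contDiffAt_snd.prodMk hG
  have hU : IsOpen (O ×ˢ (univ : Set E)) := hO.prod isOpen_univ
  have hFU : ContDiffOn ℝ 1 F (O ×ˢ (univ : Set E)) := fun pq hpq ↦
    (hF pq.1 hpq.1 pq.2).contDiffWithinAt
  -- the local flow around `z₀ = (φ y, 0)`, `C¹` in the initial value
  set z₀ : E × E := (φ y, 0) with hz₀_def
  have hz₀U : z₀ ∈ O ×ˢ (univ : Set E) := ⟨hxO, mem_univ _⟩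
  obtain ⟨fl, r, hr, ε, hε, hfl0, hfld, hflU, hfls⟩ :=
    Literature.Analysis.ODE.exists_contDiffOn_flow (n := 1) hU hFU le_rfl hz₀U
  -- initial values `(φ y, w)`, `|w| < r`, lie in the ball
  have hball : ∀ w : E, ‖w‖ < r → (φ y, w) ∈ ball z₀ r := by
    intro w hw
    rw [mem_ball, hz₀_def, Prod.dist_eq, dist_self, dist_zero_right]
    exact max_lt hr hw
  -- chart solutions are geodesics on `(-ε, ε)` with fibre coordinate `(fl _ t).2`
  have hsol : ∀ w : E, ‖w‖ < r →
      IsGeodesicOn cov (fun t ↦ φ.symm (fl (φ y, w) t).1) (Ioo (-ε) ε) ∧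
      ∀ t ∈ Ioo (-ε) ε, (e₁ (tangentLift I (fun t ↦ φ.symm (fl (φ y, w) t).1) t)).2 =
        (fl (φ y, w) t).2 := by
    intro w hw
    have hfd : ∀ t ∈ Ioo (-ε) ε, HasDerivAt (fl (φ y, w)) (F (fl (φ y, w) t)) t := fun t ht ↦
      hfld (φ y, w) (hball w hw) t ht
    exact isGeodesicOn_of_chartSolution (cov := cov) b (hN₁N.trans hNs) Ĉ
      (fun z hz i v ↦ hĈ z (hN₁N hz) i v) hO hOt hON hOr isOpen_Ioo hfd
      (fun t ht ↦ (hflU (φ y, w) (hball w hw) t ht).1)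
  have h0 : (0 : ℝ) ∈ Ioo (-ε) ε := ⟨by linarith, hε⟩
  have hyφ : φ.symm (φ y) = y := φ.left_inv (mem_extChartAt_source y)
  -- the chart solution with initial value `(φ y, w)` is `γ_w` on `(-ε, ε)`
  have heq : ∀ w : E, ‖w‖ < r → ∀ t ∈ Ioo (-ε) ε,
      maximalGeodesic cov y (show TangentSpace I y from w) t = φ.symm (fl (φ y, w) t).1 := by
    intro w hw t ht
    have hf0 : fl (φ y, w) 0 = (φ y, w) := hfl0 (φ y, w) (hball w hw)
    have hpos : φ.symm (fl (φ y, w) 0).1 = y := by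
      rw [hf0]
      exact hyφ
    have hlift : tangentLift I (fun t ↦ φ.symm (fl (φ y, w) t).1) 0 =
        TotalSpace.mk' E y (show TangentSpace I y from w) := by
      refine eq_of_trivializationAt_snd_eq (x₁ := y)
        (by show φ.symm (fl (φ y, w) 0).1 ∈ (chartAt H y).source
            rw [hpos]; exact mem_chart_source H y) hpos ?_
      rw [(hsol w hw).2 0 h0, hf0]
      exact (trivializationAt_snd_self y w).symm
    have hvel : velocity I (fun t ↦ φ.symm (fl (φ y, w) t).1) 0 = w := by
      have h := congrArg TotalSpace.snd hlift
      exact eq_of_heq ((heq_of_eq h).trans (heq_of_eq rfl))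
    obtain ⟨-, hγ, hγ0, hγv⟩ :=
      maximalGeodesic_of_isGeodesicallyComplete hc y (show TangentSpace I y from w)
    exact IsGeodesicOn.eqOn_of_velocity_eq_holds isOpen_Ioo Set.ordConnected_Ioo
      (hγ.isGeodesicOn _) (hsol w hw).1 h0 (hγ0.trans hpos.symm) (hγv.trans hvel.symm) ht
  -- the time `c = ε / 2` map
  have hc2 : ε / 2 ∈ Ioo (-ε) ε := ⟨by linarith, by linarith⟩
  refine ⟨r, hr, ε / 2, half_pos hε, fun w ↦ (fl (φ y, w) (ε / 2)).1, ?_, fun w hw ↦ ⟨?_, ?_⟩⟩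
  · -- `C¹`: the flow composed with `w ↦ ((φ y, w), ε/2)`
    have h1 : ContDiffOn ℝ 1 (fun w : E ↦ (((φ y, w), ε / 2) : (E × E) × ℝ)) (ball (0 : E) r) :=
      ((contDiffOn_const.prodMk contDiffOn_id).prodMk contDiffOn_const)
    have h2 := hfls.comp h1 fun w hw ↦ ⟨hball w (by simpa using hw), hc2⟩
    exact contDiffOn_fst.comp h2 fun _ _ ↦ mem_univ _
  · exact hOt (hflU (φ y, w) (hball w hw) (ε / 2) hc2).1
  · exact heq w hw (ε / 2) hc2

/-- **`exp_y` is `C¹` near `0 ∈ T_yM` and `d(exp_y)_0 = id`** (Lee 2018, Prop. 5.19 (c),(d)),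
read in the chart `φ = extChartAt I y`, for a geodesically complete `C¹` connection: there is
`r > 0` such that for `|v| < r` the point `exp_y v` lies in the chart domain, the map
`v ↦ φ(exp_y v)` is `C¹` on the ball `|v| < r` of `T_yM = E`, and its derivative at `0` is the
identity of `E`. Proof: `exp_y v = γ_v(1) = γ_{v/c}(c)` (rescaling lemma, Lee Lemma 5.18), and
`w ↦ φ(γ_w(c))` is a `C¹` flow map (`exists_contDiffOn_chart_maximalGeodesic`); the derivative at
`0` is computed along lines, `φ(exp_y(tv)) = φ(γ_v(t))` having derivative `v` at `t = 0` (Lee,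
proof of Prop. 5.19 (d)). [cite: LeeRiemannianManifolds2018, Prop. 5.19 (c),(d)] -/
theorem exists_ball_contDiffOn_extChartAt_expMap (hc : IsGeodesicallyComplete cov) (y : M) :
    ∃ r > (0 : ℝ),
      (∀ v : E, ‖v‖ < r → expMap cov y (show TangentSpace I y from v) ∈ (extChartAt I y).source) ∧
      ContDiffOn ℝ 1 (fun v : E => extChartAt I y (expMap cov y (show TangentSpace I y from v)))
        (ball (0 : E) r) ∧
      HasFDerivAt (fun v : E => extChartAt I y (expMap cov y (show TangentSpace I y from v)))
        (ContinuousLinearMap.id ℝ E) 0 := by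
  obtain ⟨r, hr, c, hc0, Φ, hΦ, hΦw⟩ := exists_contDiffOn_chart_maximalGeodesic hc y
  set φ := extChartAt I y with hφ_def
  set f : E → E := fun v => φ (expMap cov y (show TangentSpace I y from v)) with hf_def
  -- `exp_y v = γ_{v/c}(c) = φ⁻¹ (Φ (v / c))` for `|v| < r c`
  have hsmall : ∀ v : E, ‖v‖ < r * c → ‖c⁻¹ • v‖ < r := by
    intro v hv
    rw [norm_smul, norm_inv, Real.norm_of_nonneg hc0.le, inv_mul_lt_iff₀ hc0, mul_comm]
    exact hv
  have key : ∀ v : E, ‖v‖ < r * c →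
      expMap cov y (show TangentSpace I y from v) = φ.symm (Φ (c⁻¹ • v)) := by
    intro v hv
    have hv' : (show TangentSpace I y from v) = c • (show TangentSpace I y from c⁻¹ • v) := by
      show v = c • (c⁻¹ • v)
      rw [smul_smul, mul_inv_cancel₀ hc0.ne', one_smul]
    rw [expMap_eq_maximalGeodesic hc]
    conv_lhs => rw [hv']
    rw [maximalGeodesic_smul hc, mul_one]
    exact (hΦw (c⁻¹ • v) (hsmall v hv)).2
  have hrc : 0 < r * c := mul_pos hr hc0
  have hsrc : ∀ v : E, ‖v‖ < r * c →
      expMap cov y (show TangentSpace I y from v) ∈ (extChartAt I y).source := by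
    intro v hv
    rw [key v hv]
    exact φ.map_target (hΦw (c⁻¹ • v) (hsmall v hv)).1
  have hfeq : ∀ v ∈ ball (0 : E) (r * c), f v = Φ (c⁻¹ • v) := by
    intro v hv
    rw [mem_ball, dist_zero_right] at hv
    show φ (expMap cov y (show TangentSpace I y from v)) = Φ (c⁻¹ • v)
    rw [key v hv]
    exact φ.right_inv (hΦw (c⁻¹ • v) (hsmall v hv)).1
  have hfC : ContDiffOn ℝ 1 f (ball (0 : E) (r * c)) := by
    have h1 : ContDiffOn ℝ 1 (fun v : E => Φ (c⁻¹ • v)) (ball (0 : E) (r * c)) :=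
      hΦ.comp (contDiff_const_smul c⁻¹).contDiffOn fun v hv => by
        rw [mem_ball, dist_zero_right] at hv ⊢
        exact hsmall v hv
    exact h1.congr hfeq
  refine ⟨r * c, hrc, hsrc, hfC, ?_⟩
  -- the derivative at `0` is the identity: compute it along the lines `t ↦ t v`
  have hfd : HasFDerivAt f (fderiv ℝ f 0) 0 :=
    ((hfC.differentiableOn one_ne_zero).differentiableAt (ball_mem_nhds _ hrc)).hasFDerivAt
  suffices hid : fderiv ℝ f 0 = ContinuousLinearMap.id ℝ E by rwa [hid] at hfd
  ext v
  -- along the line: `f (t v) = φ (γ_v t)`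
  obtain ⟨-, hγ, hγ0, hγv⟩ :=
    maximalGeodesic_of_isGeodesicallyComplete hc y (show TangentSpace I y from v)
  have hline : (fun t : ℝ => f (t • v)) =
      extChartAt I y ∘ maximalGeodesic cov y (show TangentSpace I y from v) := by
    funext t
    show φ (expMap cov y (show TangentSpace I y from t • v)) = φ (maximalGeodesic cov y _ t)
    rw [show (show TangentSpace I y from t • v) = t • (show TangentSpace I y from v) from rfl,
      expMap_smul hc]
  -- derivative of `φ ∘ γ_v` at `0` is `v`
  have h1 : HasDerivAt (extChartAt I y ∘ maximalGeodesic cov y (show TangentSpace I y from v))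
      ((trivializationAt E (TangentSpace I) y
        ⟨maximalGeodesic cov y (show TangentSpace I y from v) 0,
          velocity I (maximalGeodesic cov y (show TangentSpace I y from v)) 0⟩).2) 0 :=
    hasDerivAt_extChartAt_comp (IsGeodesicOn.mdifferentiableAt_holds hγ (mem_univ 0))
      (by rw [hγ0]; exact mem_chart_source H y)
  have h2 : (trivializationAt E (TangentSpace I) y
      ⟨maximalGeodesic cov y (show TangentSpace I y from v) 0,
        velocity I (maximalGeodesic cov y (show TangentSpace I y from v)) 0⟩).2 = v := by
    have k : ∀ (z : M) (hz : maximalGeodesic cov y (show TangentSpace I y from v) 0 = z)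
        (w : TangentSpace I z)
        (hw : velocity I (maximalGeodesic cov y (show TangentSpace I y from v)) 0 = w),
        (trivializationAt E (TangentSpace I) y
          ⟨maximalGeodesic cov y (show TangentSpace I y from v) 0,
            velocity I (maximalGeodesic cov y (show TangentSpace I y from v)) 0⟩).2 =
          (trivializationAt E (TangentSpace I) y (TotalSpace.mk' E z w)).2 := by
      intro z hz w hw
      subst hz
      subst hw
      rfl
    rw [k y hγ0 _ hγv]
    exact trivializationAt_snd_self y v
  rw [h2] at h1
  rw [← hline] at h1
  -- derivative along the line from the Fréchet derivative
  have h3 : HasDerivAt (fun t : ℝ => f (t • v)) (fderiv ℝ f 0 v) 0 := by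
    have hl : HasDerivAt (fun t : ℝ => t • v) ((1 : ℝ) • v) 0 := (hasDerivAt_id (0 : ℝ)).smul_const v
    rw [one_smul] at hl
    have hfd' : HasFDerivAt f (fderiv ℝ f 0) ((fun t : ℝ => t • v) 0) := by
      rwa [show (fun t : ℝ => t • v) 0 = 0 from zero_smul ℝ v]
    exact hfd'.comp_hasDerivAt (0 : ℝ) hl
  exact h3.unique h1

end Connection

end Literature.Geometry.Riemannian
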